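import Mathlib.RingTheory.FractionalIdeal.Operations
import Literature.NumberTheory.DiophantineGeometry.FaltingsHeightIsogenyProofs
import Literature.NumberTheory.EllipticCurves.IsogenyPeriodLatticeProofs
import HarnessLib

/-!
# Faltings' isogeny inequality for elliptic curves: reduction to the finite places

Topic `NumberTheory/DiophantineGeometry`; a proofs-only file (theorems only: no definitions, no
named facts) assembling the sibling files `FaltingsHeightIsogenyProofs` (the global bookkeeping
`WeierstrassCurve.stableFaltingsHeight_le_of_multiplier`) and
`Literature.NumberTheory.EllipticCurves.IsogenyPeriodLatticeProofs` (the archimedean input: the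
multiplier `α₀ ∈ Kˣ` of a `K`-isogeny `ψ`, `ψ^*ω' = α₀ω`, satisfies
`|σα₀|² covol(Λ_σ) = deg ψ · covol(Λ'_σ)` at every complex embedding — Silverman, *AEC*,
Thm. VI.4.1(b), III.5) into the statement:

**the named fact `WeierstrassCurve.stableFaltingsHeight_le_of_isogeny`
(`h_F(E') ≤ h_F(E) + ½ log deg φ`, Faltings 1983, §3, Lemma 5) follows from its finite-place
half alone** (`stableFaltingsHeight_le_of_isogeny_of_finitePart`), namely from

  (D) for short Weierstrass models `E, E'` (`a₁ = a₂ = a₃ = 0`) of elliptic curves over a number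
  field `K`, an isogeny `ψ : E → E'` over `K` and the element `α₀ ∈ Kˣ` with
  `α₀ · (2P₂Q₁²) = (δP₁·Q₁ − P₁·δQ₁)·Q₂` on `E(K̄)` for every rational representation
  `(P₁/Q₁, P₂/Q₂)` of `ψ` (the multiplier, `ψ^*ω' = α₀ω` in coordinates), the fractional ideal
  inequality `𝔇_E · (Δ_{E'} α₀¹² / Δ_E) ⊆ 𝔇_{E'}` between the denominator ideals of `j` — i.e.
  `v(𝔇_{E'}) ≤ v(𝔇_E) + v(Δ_{E'}α₀¹²/Δ_E)` at every finite place `v`.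

(D) is the integrality of `ψ^*` on Néron differentials over a field of semistable reduction,
the term `[K:ℚ]⁻¹ log #(ω_{A₁}/φ^*ω_{A₂}) ≥ 0` of Faltings' proof of Lemma 5; it needs Néron
models / the reduction of isogenies at finite places and is **not** proved in the tree, so it
enters here as an explicit hypothesis (a hypothesis schema, not a named fact). Given (D), the
proof is: pass to the short models `C • W`, `C' • W'` (`u = 1`: same `j`, `Δ`, periods, hence the
same `h_F`, `stableFaltingsHeight_smul`; the isogeny transports with the same degree,
`Isogeny.exists_degree_eq_of_smul`), take the multiplier `α₀` of
`Isogeny.exists_multiplier_of_isShort` (archimedean inequalities by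
`norm_sq_mul_complexPeriod_le_of_lattice_le`), turn (D) into
`N(𝔇_{E'}) ≤ N(𝔇_E) |N_{K/ℚ}(Δ'α₀¹²/Δ)|` (`absNorm_le_of_coeIdeal_mul_spanSingleton_le`) and apply
`stableFaltingsHeight_le_of_multiplier`.

* `Literature.NumberTheory.DiophantineGeometry.absNorm_le_of_coeIdeal_mul_spanSingleton_le` —
  `I·(c) ⊆ J` (fractional ideals, `I ≠ 0`, `c ≠ 0`) implies `N(J) ≤ N(I)·|N_{K/ℚ}(c)|`.
* `WeierstrassCurve.stableFaltingsHeight_le_of_isogeny_of_finitePart` — **(D) implies the named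
  fact**.

## References

* [Faltings1986FinitenessTranslation] G. Faltings, *Finiteness theorems for abelian varieties
  over number fields*, in Cornell–Silverman, *Arithmetic Geometry*, Ch. II, §3, Lemma 5 and its
  proof.
* [GaudronRemondPeriodes2014] É. Gaudron, G. Rémond, *Théorème des périodes et degrés minimaux
  d'isogénies*, Comment. Math. Helv. 89 (2014), §2.3.
* [SilvermanAEC2009] J. H. Silverman, *The Arithmetic of Elliptic Curves*, 2nd ed., III.5,
  Thm. VI.4.1.
-/

noncomputable section

open scoped Classical nonZeroDivisors

namespace Literature.NumberTheory.DiophantineGeometry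

open NumberField

variable {K : Type*} [Field K] [NumberField K]

/-- **From the ideal inequality to the norm inequality.** For integral ideals `I ≠ 0`, `J` of
`𝓞_K` and `c ∈ Kˣ`, if `I·(c) ⊆ J` as fractional ideals then `N(J) ≤ N(I)·|N_{K/ℚ}(c)|`:
write `c = a/b` with `a, b ∈ 𝓞_K` (`IsFractionRing.div_surjective`), so that `I·(a) ⊆ J·(b)`
and `N(J)|N(b)| ≤ N(I)|N(a)|` (`absNorm_mul_abs_norm_le`), while `|N(c)| = |N(a)|/|N(b)|`.
[folklore] -/
theorem absNorm_le_of_coeIdeal_mul_spanSingleton_le {I J : Ideal (𝓞 K)} (hI : I ≠ ⊥) {c : K}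
    (hc : c ≠ 0)
    (h : (I : FractionalIdeal (𝓞 K)⁰ K) * FractionalIdeal.spanSingleton (𝓞 K)⁰ c ≤ J) :
    (Ideal.absNorm J : ℝ) ≤ Ideal.absNorm I * |((Algebra.norm ℚ c : ℚ) : ℝ)| := by
  obtain ⟨a, b, hb, hab⟩ := IsFractionRing.div_surjective (A := 𝓞 K) c
  have hb0 : b ≠ 0 := nonZeroDivisors.ne_zero hb
  have hbK : algebraMap (𝓞 K) K b ≠ 0 := fun h0 ↦
    hb0 (IsFractionRing.injective (𝓞 K) K (by rw [h0, map_zero]))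
  have ha0 : a ≠ 0 := by
    rintro rfl
    rw [map_zero, zero_div] at hab
    exact hc hab.symm
  have hca : algebraMap (𝓞 K) K a = c * algebraMap (𝓞 K) K b := by
    rw [← hab, div_mul_cancel₀ _ hbK]
  -- `I·(a) ⊆ J·(b)` as integral ideals
  have h' : I * Ideal.span {a} ≤ J * Ideal.span {b} := by
    rw [← FractionalIdeal.coeIdeal_le_coeIdeal K, FractionalIdeal.coeIdeal_mul,
      FractionalIdeal.coeIdeal_mul, FractionalIdeal.coeIdeal_span_singleton,
      FractionalIdeal.coeIdeal_span_singleton, hca,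
      ← FractionalIdeal.spanSingleton_mul_spanSingleton, ← mul_assoc]
    gcongr
  have key := absNorm_mul_abs_norm_le hI ha0 h'
  -- `|N(c)| = |N(a)| / |N(b)|`
  have hNb : (0 : ℝ) < |((Algebra.norm ℚ (b : K) : ℚ) : ℝ)| := by
    rw [abs_pos, Rat.cast_ne_zero]
    exact Algebra.norm_ne_zero_iff.mpr (by rw [RingOfIntegers.coe_eq_algebraMap]; exact hbK)
  have hNc : |((Algebra.norm ℚ c : ℚ) : ℝ)| * |((Algebra.norm ℚ (b : K) : ℚ) : ℝ)| =
      |((Algebra.norm ℚ (a : K) : ℚ) : ℝ)| := by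
    rw [← abs_mul, ← Rat.cast_mul, ← map_mul, RingOfIntegers.coe_eq_algebraMap,
      RingOfIntegers.coe_eq_algebraMap, ← hca]
  rw [← hNc, ← mul_assoc] at key
  exact le_of_mul_le_mul_right key hNb

end Literature.NumberTheory.DiophantineGeometry

namespace WeierstrassCurve

open NumberField Literature.NumberTheory.DiophantineGeometry

/-- **Faltings' isogeny inequality for elliptic curves follows from its finite-place half.**
Assume (D): for short Weierstrass models `E, E'` (`a₁ = a₂ = a₃ = 0`) of elliptic curves over
a number field `K`, an isogeny `ψ : E → E'` over `K`, and `α₀ ∈ Kˣ` satisfying the coordinate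
identity `α₀ · (2P₂Q₁²)(x, y) = ((δP₁·Q₁ − P₁·δQ₁)·Q₂)(x, y)` at all affine `(x, y) ∈ E(K̄)` for
all rational representations `(P₁/Q₁, P₂/Q₂)` of `ψ` (i.e. `ψ^*ω' = α₀ω`, Silverman *AEC*
III.5), one has `𝔇_E · (Δ_{E'}α₀¹²/Δ_E) ⊆ 𝔇_{E'}` (denominator ideals of `j`, as fractional
ideals) — the integrality of `ψ^*` on Néron differentials, `#(ω_{A₁}/φ^*ω_{A₂}) ≥ 1` in
Faltings' proof of Lemma 5. Then `h_F(E') ≤ h_F(E) + ½ log deg φ` for every isogeny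
`φ : E → E'` of elliptic curves over a number field (the named fact
`stableFaltingsHeight_le_of_isogeny`): reduce to short models (`stableFaltingsHeight_smul`,
`Isogeny.exists_degree_eq_of_smul`), take the multiplier of
`Isogeny.exists_multiplier_of_isShort` (archimedean input `|σα₀|²·cp(E^σ) ≤ deg·cp(E'^σ)`,
Silverman *AEC* VI.4.1(b)), and conclude by `stableFaltingsHeight_le_of_multiplier`.
(Dot-notation extension of Mathlib's `WeierstrassCurve`.)
[cite: Faltings1986FinitenessTranslation, §3 Lemma 5 (proof)] -/
theorem stableFaltingsHeight_le_of_isogeny_of_finitePart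
    (hfin : ∀ {K : Type} [Field K] [NumberField K] {E E' : WeierstrassCurve K} [E.IsElliptic]
      [E'.IsElliptic] (ψ : Isogeny E E') {α₀ : K},
      E.a₁ = 0 → E.a₂ = 0 → E.a₃ = 0 → E'.a₁ = 0 → E'.a₂ = 0 → E'.a₃ = 0 → α₀ ≠ 0 →
      (∀ (ρ : RatRep E E' ψ) (x y : AlgebraicClosure K)
        (_ : (E.baseChange (AlgebraicClosure K)).toAffine.Nonsingular x y),
        algebraMap K (AlgebraicClosure K) α₀ *
            MvPolynomial.eval ![x, y] (MvPolynomial.C 2 * ρ.P₂ * ρ.Q₁ ^ 2) =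
          MvPolynomial.eval ![x, y]
            (((E.baseChange (AlgebraicClosure K)).invariantDerivation ρ.P₁ * ρ.Q₁ -
              ρ.P₁ * (E.baseChange (AlgebraicClosure K)).invariantDerivation ρ.Q₁) * ρ.Q₂)) →
      (E.jDenominatorIdeal : FractionalIdeal (𝓞 K)⁰ K) *
          FractionalIdeal.spanSingleton (𝓞 K)⁰ (E'.Δ * α₀ ^ 12 / E.Δ) ≤
        (E'.jDenominatorIdeal : FractionalIdeal (𝓞 K)⁰ K)) :
    stableFaltingsHeight_le_of_isogeny := by
  intro K _ _ W W' _ _ φ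
  classical
  haveI : Invertible (2 : K) := invertibleOfNonzero two_ne_zero
  haveI : Invertible (3 : K) := invertibleOfNonzero three_ne_zero
  set C : VariableChange K := ⟨1, -W.b₂ / 12, -W.a₁ / 2, W.a₁ * W.b₂ / 24 - W.a₃ / 2⟩ with hC
  set C' : VariableChange K := ⟨1, -W'.b₂ / 12, -W'.a₁ / 2, W'.a₁ * W'.b₂ / 24 - W'.a₃ / 2⟩
    with hC'
  obtain ⟨h₁, h₂, h₃⟩ := Isogeny.shortChange_a₁_a₂_a₃ W
  obtain ⟨h₁', h₂', h₃'⟩ := Isogeny.shortChange_a₁_a₂_a₃ W'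
  obtain ⟨ψ, hψ⟩ := φ.exists_degree_eq_of_smul C C'
  obtain ⟨α₀, hα₀, hcoord, han⟩ := ψ.exists_multiplier_of_isShort h₁ h₂ h₃ h₁' h₂' h₃'
  have hideal := hfin ψ h₁ h₂ h₃ h₁' h₂' h₃' hα₀ hcoord
  -- the archimedean inequalities
  have harch : ∀ σ : K →+* ℂ, ‖σ α₀‖ ^ 2 * ((C • W).map σ).complexPeriod ≤
      ψ.degree * ((C' • W').map σ).complexPeriod := by
    intro σ
    obtain ⟨L, hL₂, hL₃⟩ := ((C • W).map σ).exists_periodPair_of_isElliptic'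
    obtain ⟨L', hL₂', hL₃'⟩ := ((C' • W').map σ).exists_periodPair_of_isElliptic'
    obtain ⟨hσ, hle, hdeg⟩ := han σ L L' hL₂ hL₃ hL₂' hL₃'
    exact norm_sq_mul_complexPeriod_le_of_lattice_le hL₂ hL₃ hL₂' hL₃' hσ hle hdeg.le
  -- the finite inequality, in norm form
  have hμ0 : (C' • W').Δ * α₀ ^ 12 / (C • W).Δ ≠ 0 :=
    div_ne_zero (mul_ne_zero (C' • W').isUnit_Δ.ne_zero (pow_ne_zero _ hα₀))
      (C • W).isUnit_Δ.ne_zero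
  have hnorm := absNorm_le_of_coeIdeal_mul_spanSingleton_le (C • W).jDenominatorIdeal_ne_bot
    hμ0 hideal
  have key := stableFaltingsHeight_le_of_multiplier (C • W) (C' • W') ψ.degree_pos hα₀ harch hnorm
  rwa [stableFaltingsHeight_smul, stableFaltingsHeight_smul, hψ] at key

end WeierstrassCurve

end
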